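import Literature.Analysis.FluidPDE.SignedPowers
import Literature.Analysis.FluidPDE.LeiZhang2011Cutoff
import Literature.Analysis.FluidPDE.NSSereginDecaySliceTerms
import Mathlib.Analysis.Calculus.Gradient.Basic
import HarnessLib

/-!
# Seregin 2020, Lemma 2.2 (after Nazarov–Uraltseva 2012): the `C²` test profile
# `H(τ) = ((2l - τ)₊)³` of the De Giorgi energy arguments, and two gradient identities

Helper toward the stub `stub_seregin2020TypeII` of the crux `AxisymmetricKatoGlobal` (= the named
fact `Literature.Analysis.FluidPDE.Seregin2020_axisymmetricSingularPoint_typeII`, G. Seregin,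
Anal. Math. Phys. 10 (2020) Paper 46 = arXiv:2006.04140, Thm 2.1), reduced in the tree to the
written-out hypothesis `hWH′` (corrected Lemma 2.2 = Nazarov–Uraltseva 2012 Lemma 4.2 for the
class 𝒱). The energy-inequality class of the cell's De Giorgi skeleton
(`Cruxes/AxisymmetricKatoGlobal/Seregin2020Lemma22ExpansionOfPositivity.lean`, `EnergyClass`) is
tested with profiles `H ∈ C²`, `H' ≤ 0 ≤ H, H''`, `H'² ≤ 2HH''`, vanishing on `[k, ∞)` (N–U's
Remark 9: only levels below the axis value `k` are tested). N–U use `(k_m - τ)₊²`, which is not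
`C²`; the cube `((2l - τ)₊)³` is (`SignedPowers`), vanishes on `[2l, ∞) ⊆ [k, ∞)` for `2l ≤ k`,
and still has `H'' = 6(2l - τ)₊ ≥ 6l` on the sublevel set `{τ < l}`, which is what (3.12)
needs. Contents:

* `fderiv_sq_apply`, `norm_gradient_sq_le` — `D(Θ²) = 2Θ DΘ`, `‖∇(Θ²)‖ ≤ 2|Θ| ‖DΘ‖`
  (`‖∇f‖ = ‖Df‖` is the tree's `norm_gradient_eq_norm_fderiv`);
* `cubeProfile_props` — the eight properties of `H(τ) = ((2l - τ)₊)³` listed in its docstring;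
* `radialCutoff_energy_props` — the facts about `Θ = radialCutoff ρ ρ₁` used against the class
  (`C¹`, compact support in `B̄(ρ₁)`, `0 ≤ Θ ≤ 1`, `Θ = 1` on `B(ρ)`, `Θ`, `DΘ`, `∇(Θ²)` vanish
  off `B̄(ρ₁)`);
* `integral_le_of_le_indicator_const` — `∫ f ≤ M |K|` when `|f| ≤ M 1_K` pointwise;
* `setLIntegral_Ioo_prod_inter_le_iSup` — `∫∫_{(]a,t₀[ × B) ∩ P} f ≤ ⨆ₙ ∫∫_{([a,tₙ] × B) ∩ P} f`
  for the times `tₙ = t₀ - (t₀ - a)/(n+2) ↑ t₀` (monotone convergence on sets).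

## References

* A. I. Nazarov, N. N. Uraltseva, St. Petersburg Math. J. 23 (2012) 93–115 = arXiv:1011.1888,
  §3, (3.2), (3.9), Remark 9 (the profiles `φ(τ) = τ₊^p`, `(V - k)₋²`). [NazarovUraltseva2012]
* G. Seregin, Anal. Math. Phys. 10 (2020), Paper 46 = arXiv:2006.04140, Lemma 2.2. [Seregin2020]
-/

-- the problem directory repeats the summit name (D-0017); core's `dupNamespace` linter fires
set_option linter.dupNamespace false

noncomputable section

open MeasureTheory Set Function Filter Topology Metric Module
open scoped NNReal ENNReal

namespace Summit.NavierStokesRegularity.NavierStokesRegularity.Theorems.AxisymmetricKatoGlobal.EulerScaling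

open Literature.Analysis.FluidPDE Literature.Analysis.FluidPDE.LeiZhang2011

/-! ### Small tools -/

/-- The derivative of the square of a `C¹` function: `D(Θ²)(x)[v] = 2 Θ(x) DΘ(x)[v]`. [folklore] -/
theorem fderiv_sq_apply {Θ : EuclideanSpace ℝ (Fin 3) → ℝ} (hΘ : ContDiff ℝ 1 Θ)
    (x v : EuclideanSpace ℝ (Fin 3)) :
    fderiv ℝ (fun y => Θ y ^ 2) x v = 2 * Θ x * fderiv ℝ Θ x v := by
  have hd : DifferentiableAt ℝ Θ x := (hΘ.differentiable one_ne_zero) x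
  have h := hd.hasFDerivAt.pow 2
  rw [h.fderiv]
  simp only [smul_apply, smul_eq_mul]
  ring

/-- `∇(Θ²)(x) = 2Θ(x) ∇Θ(x)`, hence `‖∇(Θ²)(x)‖ ≤ 2 |Θ(x)| ‖DΘ(x)‖`. [folklore] -/
theorem norm_gradient_sq_le {Θ : EuclideanSpace ℝ (Fin 3) → ℝ} (hΘ : ContDiff ℝ 1 Θ)
    (x : EuclideanSpace ℝ (Fin 3)) :
    ‖gradient (fun y => Θ y ^ 2) x‖ ≤ 2 * |Θ x| * ‖fderiv ℝ Θ x‖ := by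
  rw [norm_gradient_eq_norm_fderiv]
  refine ContinuousLinearMap.opNorm_le_bound _ (by positivity) fun v => ?_
  rw [fderiv_sq_apply hΘ, Real.norm_eq_abs, abs_mul, abs_mul, abs_two]
  have h := ContinuousLinearMap.le_opNorm (fderiv ℝ Θ x) v
  rw [Real.norm_eq_abs] at h
  calc 2 * |Θ x| * |fderiv ℝ Θ x v| ≤ 2 * |Θ x| * (‖fderiv ℝ Θ x‖ * ‖v‖) := by gcongr
    _ = 2 * |Θ x| * ‖fderiv ℝ Θ x‖ * ‖v‖ := by ring

/-! ### The profile `H(τ) = ((2l - τ)₊)³` -/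

/-- Properties of the `C²` profile `H(τ) = ((2l - τ)₊)³` used against the energy class:
`H ∈ C²`, `H' = -3(2l-τ)₊² ≤ 0`, `H ≥ 0`, `H'' = 6(2l-τ)₊ ≥ 0`, `H'² ≤ 2HH''` (indeed
`≤ (3/2)HH''`), `H = 0` on `[2l, ∞)`, `H ≤ 8l³` on `[0, ∞)` and `H'' ≥ 6l` on `]-∞, l]`
(`l > 0`). [folklore] -/
theorem cubeProfile_props {l : ℝ} (hl : 0 < l) :
    ContDiff ℝ 2 (fun τ : ℝ => max (2 * l - τ) 0 ^ (3 : ℝ)) ∧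
    (∀ v, deriv (fun τ : ℝ => max (2 * l - τ) 0 ^ (3 : ℝ)) v ≤ 0) ∧
    (∀ v, 0 ≤ max (2 * l - v) 0 ^ (3 : ℝ)) ∧
    (∀ v, 0 ≤ deriv (deriv fun τ : ℝ => max (2 * l - τ) 0 ^ (3 : ℝ)) v) ∧
    (∀ v, deriv (fun τ : ℝ => max (2 * l - τ) 0 ^ (3 : ℝ)) v ^ 2 ≤
      2 * max (2 * l - v) 0 ^ (3 : ℝ) * deriv (deriv fun τ : ℝ => max (2 * l - τ) 0 ^ (3 : ℝ)) v) ∧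
    (∀ v, 2 * l ≤ v → max (2 * l - v) 0 ^ (3 : ℝ) = 0) ∧
    (∀ v, 0 ≤ v → max (2 * l - v) 0 ^ (3 : ℝ) ≤ 8 * l ^ 3) ∧
    (∀ v, v ≤ l → 6 * l ≤ deriv (deriv fun τ : ℝ => max (2 * l - τ) 0 ^ (3 : ℝ)) v) := by
  have h3 : (2 : ℝ) < 3 := by norm_num
  refine ⟨contDiff_two_posPart_const_sub_rpow h3 _, fun v => ?_, fun v => posPart_rpow_nonneg _ _,
    fun v => deriv_deriv_posPart_const_sub_rpow_nonneg h3 _ v, fun v => ?_, fun v hv => ?_,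
    fun v hv => ?_, fun v hv => ?_⟩
  · rw [deriv_posPart_const_sub_rpow h3]
    show -(3 * max (2 * l - v) 0 ^ ((3 : ℝ) - 1)) ≤ 0
    have := posPart_rpow_nonneg (2 * l - v) ((3 : ℝ) - 1)
    linarith [mul_nonneg (by norm_num : (0 : ℝ) ≤ 3) this]
  · have h := deriv_posPart_const_sub_rpow_sq_le h3 (2 * l) v
    have hHH : 0 ≤ max (2 * l - v) 0 ^ (3 : ℝ) *
        deriv (deriv fun τ : ℝ => max (2 * l - τ) 0 ^ (3 : ℝ)) v :=
      mul_nonneg (posPart_rpow_nonneg _ _) (deriv_deriv_posPart_const_sub_rpow_nonneg h3 _ v)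
    have h32 : (3 : ℝ) / (3 - 1) ≤ 2 := by norm_num
    calc deriv (fun τ : ℝ => max (2 * l - τ) 0 ^ (3 : ℝ)) v ^ 2
        ≤ 3 / (3 - 1) * (max (2 * l - v) 0 ^ (3 : ℝ) *
            deriv (deriv fun τ : ℝ => max (2 * l - τ) 0 ^ (3 : ℝ)) v) := h
      _ ≤ 2 * (max (2 * l - v) 0 ^ (3 : ℝ) *
            deriv (deriv fun τ : ℝ => max (2 * l - τ) 0 ^ (3 : ℝ)) v) :=
          mul_le_mul_of_nonneg_right h32 hHH
      _ = _ := by ring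
  · exact posPart_rpow_of_nonpos (by linarith) (by norm_num)
  · have h0 : 0 ≤ max (2 * l - v) 0 := le_max_right _ _
    have h1 : max (2 * l - v) 0 ≤ 2 * l := max_le (by linarith) (by linarith)
    calc max (2 * l - v) 0 ^ (3 : ℝ) ≤ (2 * l) ^ (3 : ℝ) :=
          Real.rpow_le_rpow h0 h1 (by norm_num)
      _ = 8 * l ^ 3 := by
          rw [show (3 : ℝ) = ((3 : ℕ) : ℝ) by norm_num, Real.rpow_natCast]; ring
  · rw [deriv_deriv_posPart_const_sub_rpow h3]
    have h1 : l ≤ max (2 * l - v) 0 := le_max_of_le_left (by linarith)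
    have e : max (2 * l - v) 0 ^ ((3 : ℝ) - 2) = max (2 * l - v) 0 := by
      rw [show (3 : ℝ) - 2 = 1 by norm_num, Real.rpow_one]
    show 6 * l ≤ 3 * (3 - 1) * max (2 * l - v) 0 ^ ((3 : ℝ) - 2)
    rw [e]
    nlinarith


/-! ### The radial cut-off -/

/-- The facts about `Θ = radialCutoff ρ ρ₁`, `0 < ρ < ρ₁`, used against the energy class: `C¹`,
compact support inside `B̄(0, ρ₁)`, `0 ≤ Θ ≤ 1`, `Θ = 1` on `B(0, ρ)`, and `Θ`, `DΘ`, `∇(Θ²)`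
vanish off `B̄(0, ρ₁)`. [folklore] -/
theorem radialCutoff_energy_props {ρ ρ₁ : ℝ} (hρ : 0 < ρ) (hρ₁ : ρ < ρ₁) :
    ContDiff ℝ 1 (radialCutoff ρ ρ₁ : EuclideanSpace ℝ (Fin 3) → ℝ) ∧
    HasCompactSupport (radialCutoff ρ ρ₁ : EuclideanSpace ℝ (Fin 3) → ℝ) ∧
    tsupport (radialCutoff ρ ρ₁ : EuclideanSpace ℝ (Fin 3) → ℝ) ⊆
      closedBall (0 : EuclideanSpace ℝ (Fin 3)) ρ₁ ∧
    (∀ x : EuclideanSpace ℝ (Fin 3), 0 ≤ radialCutoff ρ ρ₁ x ∧ radialCutoff ρ ρ₁ x ≤ 1) ∧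
    (∀ x ∈ ball (0 : EuclideanSpace ℝ (Fin 3)) ρ, radialCutoff ρ ρ₁ x = 1) ∧
    (∀ x : EuclideanSpace ℝ (Fin 3), x ∉ closedBall (0 : EuclideanSpace ℝ (Fin 3)) ρ₁ →
      radialCutoff ρ ρ₁ x = 0 ∧ fderiv ℝ (radialCutoff ρ ρ₁ : EuclideanSpace ℝ (Fin 3) → ℝ) x = 0 ∧
        gradient (fun y : EuclideanSpace ℝ (Fin 3) => radialCutoff ρ ρ₁ y ^ 2) x = 0) := by
  refine ⟨radialCutoff_contDiff ρ ρ₁, hasCompactSupport_radialCutoff hρ.le hρ₁,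
    tsupport_radialCutoff_subset hρ.le hρ₁,
    fun x => ⟨radialCutoff_nonneg _ _ _, radialCutoff_le_one _ _ _⟩,
    fun x hx => radialCutoff_eq_one hρ.le hρ₁ (mem_ball_zero_iff.1 hx).le, fun x hx => ?_⟩
  have hx' : ρ₁ < ‖x‖ := by rwa [mem_closedBall_zero_iff, not_le] at hx
  have hev : (radialCutoff ρ ρ₁ : EuclideanSpace ℝ (Fin 3) → ℝ) =ᶠ[𝓝 x] fun _ => 0 :=
    radialCutoff_eventuallyEq_zero hρ.le hρ₁ hx'
  have hev2 : (fun y : EuclideanSpace ℝ (Fin 3) => radialCutoff ρ ρ₁ y ^ 2) =ᶠ[𝓝 x] fun _ => 0 := by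
    filter_upwards [hev] with y hy; simp [hy]
  refine ⟨radialCutoff_eq_zero hρ.le hρ₁ hx'.le, ?_, ?_⟩
  · rw [hev.fderiv_eq, fderiv_const_apply]
  · unfold gradient
    rw [hev2.fderiv_eq]
    simp

/-! ### Two integration tools -/

/-- If `|f| ≤ M` on a set `K` of finite measure and `f = 0` off `K`, then `∫ f ≤ M |K|` (no
integrability needed: through `‖∫ f‖ ≤ ∫⁻ ‖f‖`). [folklore] -/
theorem integral_le_of_le_indicator_const {f : EuclideanSpace ℝ (Fin 3) → ℝ}
    {K : Set (EuclideanSpace ℝ (Fin 3))} (hK : MeasurableSet K) (hKfin : volume K ≠ ∞)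
    {M : ℝ} (hM : 0 ≤ M) (hf : ∀ x ∈ K, |f x| ≤ M) (hf0 : ∀ x, x ∉ K → f x = 0) :
    ∫ x, f x ≤ M * (volume K).toReal := by
  have h1 := norm_integral_le_lintegral_norm (μ := volume) f
  have h2 : ∫⁻ x, ENNReal.ofReal ‖f x‖ ≤ ∫⁻ x, K.indicator (fun _ => ENNReal.ofReal M) x := by
    refine lintegral_mono fun x => ?_
    by_cases hx : x ∈ K
    · rw [indicator_of_mem hx, Real.norm_eq_abs]; exact ENNReal.ofReal_le_ofReal (hf x hx)
    · rw [indicator_of_notMem hx, hf0 x hx]; simp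
  rw [lintegral_indicator_const hK] at h2
  calc ∫ x, f x ≤ ‖∫ x, f x‖ := Real.le_norm_self _
    _ ≤ (∫⁻ x, ENNReal.ofReal ‖f x‖).toReal := h1
    _ ≤ (ENNReal.ofReal M * volume K).toReal :=
        ENNReal.toReal_mono (ENNReal.mul_ne_top ENNReal.ofReal_ne_top hKfin) h2
    _ = M * (volume K).toReal := by rw [ENNReal.toReal_mul, ENNReal.toReal_ofReal hM]

/-- **Monotone convergence on the cylinders `[a, tₙ] × B ↑ ]a, t₀[ × B`**: for
`tₙ = t₀ - (t₀ - a)/(n + 2)` (`a ≤ tₙ < t₀`) and any `P`, `f`,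
`∫∫_{(]a,t₀[ × B) ∩ P} f ≤ ⨆ₙ ∫∫_{([a,tₙ] × B) ∩ P} f`. [folklore] -/
theorem setLIntegral_Ioo_prod_inter_le_iSup {a t₀ : ℝ} (hat : a < t₀)
    (B : Set (EuclideanSpace ℝ (Fin 3))) (P : Set (ℝ × EuclideanSpace ℝ (Fin 3)))
    (f : ℝ × EuclideanSpace ℝ (Fin 3) → ℝ≥0∞) :
    (∀ n : ℕ, a ≤ t₀ - (t₀ - a) / ((n : ℝ) + 2) ∧ t₀ - (t₀ - a) / ((n : ℝ) + 2) < t₀) ∧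
    ∫⁻ z in (Ioo a t₀ ×ˢ B) ∩ P, f z ≤
      ⨆ n : ℕ, ∫⁻ z in (Icc a (t₀ - (t₀ - a) / ((n : ℝ) + 2)) ×ˢ B) ∩ P, f z := by
  have hta : 0 < t₀ - a := by linarith
  set tn : ℕ → ℝ := fun n => t₀ - (t₀ - a) / ((n : ℝ) + 2) with htn
  have htn_ge : ∀ n, a ≤ tn n := by
    intro n
    have h2 : (1 : ℝ) ≤ (n : ℝ) + 2 := by have := Nat.cast_nonneg (α := ℝ) n; linarith
    have : (t₀ - a) / ((n : ℝ) + 2) ≤ t₀ - a := div_le_self hta.le h2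
    simp only [htn]; linarith
  have htn_lt : ∀ n, tn n < t₀ := by
    intro n
    have : 0 < (t₀ - a) / ((n : ℝ) + 2) := by positivity
    simp only [htn]; linarith
  refine ⟨fun n => ⟨htn_ge n, htn_lt n⟩, ?_⟩
  set Sn : ℕ → Set (ℝ × EuclideanSpace ℝ (Fin 3)) := fun n => (Icc a (tn n) ×ˢ B) ∩ P with hSn
  have hmono : Monotone Sn := by
    intro n m hnm
    have h : tn n ≤ tn m := by
      simp only [htn]
      have h1 : (0 : ℝ) < (n : ℝ) + 2 := by positivity
      have h2 : ((n : ℝ) + 2) ≤ (m : ℝ) + 2 := by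
        have := Nat.cast_le (α := ℝ).2 hnm; linarith
      have := div_le_div_of_nonneg_left hta.le h1 h2
      linarith
    exact inter_subset_inter_left _ (prod_mono (Icc_subset_Icc le_rfl h) le_rfl)
  have hcover : (Ioo a t₀ ×ˢ B) ∩ P ⊆ ⋃ n, Sn n := by
    rintro z ⟨⟨hz1, hz2⟩, hz3⟩
    have hgap : 0 < t₀ - z.1 := by linarith [hz1.2]
    obtain ⟨n, hn⟩ := exists_nat_ge ((t₀ - a) / (t₀ - z.1))
    refine mem_iUnion.2 ⟨n, ⟨⟨hz1.1.le, ?_⟩, hz2⟩, hz3⟩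
    have h1 : (t₀ - a) / (t₀ - z.1) ≤ (n : ℝ) + 2 := by linarith
    have h2 : (t₀ - a) / ((n : ℝ) + 2) ≤ t₀ - z.1 := by
      rw [div_le_iff₀ (by positivity)]
      have := (div_le_iff₀ hgap).1 h1
      linarith
    show z.1 ≤ t₀ - (t₀ - a) / ((n : ℝ) + 2)
    linarith
  calc ∫⁻ z in (Ioo a t₀ ×ˢ B) ∩ P, f z ≤ ∫⁻ z in ⋃ n, Sn n, f z := lintegral_mono_set hcover
    _ = ⨆ n, ∫⁻ z in Sn n, f z := setLIntegral_iUnion_of_directed _ hmono.directed_le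
    _ = _ := rfl

end Summit.NavierStokesRegularity.NavierStokesRegularity.Theorems.AxisymmetricKatoGlobal.EulerScaling

end
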